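import Summits.QuantumFields.BalabanUV.Beta.GAN24.LayerFluxSupport
import Summits.QuantumFields.BalabanUV.Beta.GAN24.LayerCommutatorSupport

/-!
# `BalabanUV.Beta.GAN24.LayerLetterFaces` — binder row G-an2-4 ∕ (CONV-C), W-slot CT-W, route «WC-TL» ∕ (Q-R) «QR-LL», row (LAY), programme
# «(LAY-LIT) THE LITERAL's LETTER PROFILE ROWS `hS ∧ hω` OF THE (Q-R) END», PART 1:
# **FACE LETTERS AT A GENERAL ANCHOR** — the face weight `FW_U(q)` of a finite fine region `U`, its monotonicity ∕ re-anchoring ∕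
# STRADDLE lemmas, and this lineage's two (LAY) support letters (the block-summed divergence (A), the block-generator commutator (B))
# re-based from the slot point to an ARBITRARY anchor `q` and written in FACE-SUM form (G-an2-4 formalisation swarm → CRUX TEAM (2),
# leaf prover `b2b-balaban-gan24-formalise-leaf-03`, gen 61; INTENT 1, journal `CLAIMS.log`; names PROVISIONAL — the OWNER gan24-p1 ∕
# leaf-01 ((LT) consumer) may rename ∕ re-cut)

NOT IN PRINT; OUR BOOKKEEPING ([folklore] lattice geometry on `ℤ^{d+1}` + triangle inequalities over this lineage's g58
`BlockDivergenceFlux.finsetSum_divV_eq_layers`, `LayerCommutatorSupport.exists_face_between ∕ comm_diagK_entry ∕ smul_sum_legInd_apply ∕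
l1_legSite_sub_le` and the tree's `BiLoc` BY NAME; generic `d`; 0 `def`, 0 cited facts, 0 `def … : Prop`, 0 sorry).  HONEST FRAMING (cell
contract, verbatim): «discharging `BetaPertH` makes Bałaban's UV stability UNCONDITIONAL — a real constructive-QFT result; it is NOT the
continuum limit and NOT the Clay problem.»  HONEST DEPENDENCY (verbatim): «continuum YM on T⁴ ⇐ BetaPertH ∧ nine spine estimates (0/9 proved);
BetaPertH ⇐ (D1) ∧ (D4) ∧ CAP+tail; G-an2-4 gates asym, D1 and NE2/3/4.»

## Why (the programme)
The OWNER gan24-p1 g28's (Q-R) END `WardRemainderEndThree.wLocStencil_unitS_of_layer ∕ …three` DISPLAYS, for the literal sandwich letter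
`S_m = unitS_{m+1}(Σ_{w∈box L} σ m (L•Y + w))` of `WardResidualSUnrolled.exists_kernelLaws_unrolled`, the two letter PROFILE rows
`hS : |S_m k′ u x z a b| ≤ Cs·ω m u·e^{−m′(‖x−u‖₁+‖z−u‖₁)}` and `hω : 0 ≤ ω m u ≤ (sum of e^{−δ‖v−u‖₁} over the exit ∕ entry faces of the super-block)`.
At the identity level the super-block label sum of every piece of the explicit first-order data `Ψ` is a FACE expression (p2 g37
`WardResidualLabelSums`: the generators add up to the generator `X_T` of the fine union `U`, the rotated vertices to `dM([G, X_T]) S M`, the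
table-law remainders to «flux over `U` minus `[·, X_T]`», the gauge weights to `∇𝟙_U`; leaf-06 g44 `GaugeReadLayerForm`: the gauge read in
cancelled layer form).  The programme (LAY-LIT) supplies the ESTIMATES: every such face expression is `BiLoc` at the slot anchor `q = N•y′` with
constant `C·FW_U(q)`, where (written out below, NO `def`)
`FW_U^δ(q) := Σ_μ (Σ_{w ∈ (U − e_μ) ∖ U} e^{−δ‖w−q‖₁} + Σ_{w ∈ U ∖ (U − e_μ)} e^{−δ‖w−q‖₁})`
is the FACE WEIGHT of `U` at `q` (outer faces = the layer ENTERING `U`, inner faces = the layer EXITING it, direction by direction — the index sets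
of `BlockDivergenceFlux.finsetSum_divV_eq_layers` and of this lineage's g58 weight form `LayerFluxSupport.biLoc_finsetSum_divV_weight`).

## What (this file = PART 1, the geometric core shared by the pieces (α) ∕ (β) ∕ (γ))
* §1 THE FACE WEIGHT: `exp_le_faceW_of_mem` (one layer site is dominated by the weight), `faceW_nonneg`, `faceW_mono_rate`
  (`δ′ ≤ δ ⇒ FW^δ ≤ FW^{δ′}`), `faceW_reanchor` (`FW^δ(q) ≤ e^{δ‖q−q′‖₁}·FW^δ(q′)`).
* §2 STRADDLES: **`exists_face_l1_le`** (`r₁ ∈ U`, `r₂ ∉ U` ⇒ a layer site `w` with `‖w−q‖₁ ≤ ‖r₁−q‖₁ + ‖r₂−q‖₁`, any anchor `q` — from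
  `exists_face_between`); **`exp_straddle_le_faceW`** (`e^{−δ(‖r₁−q‖₁+‖r₂−q‖₁)} ≤ FW^{δ∕2}(q)·e^{−(δ∕2)(‖r₁−q‖₁+‖r₂−q‖₁)}`);
  **`indDiff_mul_exp_le_faceW`** (abstract-weight form `indDiff_mul_exp_le_of_faceBound`: any `W ≥ 0` dominating `e^{−(δ∕2)‖w−q‖₁}` on the
  layer) — the WEIGHT LEMMA of the rotated-vertex piece (α): an indicator difference `𝟙_U(s)ξ − 𝟙_U(t)ξ` (slot leg `s` against table leg `t`)
  times a column decay `e^{−δ‖v−q‖₁}` is `≤ |ξ|·e^{(δ∕2)(‖s−q‖₁+‖t−v‖₁)}·FW^{δ∕2}(q)·e^{−(δ∕2)‖v−q‖₁}` — ZERO unless the two legs straddle `∂U`,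
  and then half the column decay pays for the distance from the anchor to the layer.
* §3 (A) AT A GENERAL ANCHOR: **`biLoc_finsetSum_divV_anchor`** — `(∀ μ x′, BiLoc (F μ x′) q q (C·e^{−δ‖x′−q‖₁}) δ) ⇒
  BiLoc (Σ_{x′∈U} divV F x′) q q (C·FW^δ(q)) δ` (g58's weight form had the anchor AT the slot point; the mixed-remainder piece (β) of `Ψ` is
  anchored at the DILATED multiplier slot `N•w`, hence the general anchor).
* §4 (B) AT A GENERAL ANCHOR, FACE-SUM FORM: **`biLoc_comm_diagK_legInd_anchor`** ∕ `biLoc_conjV_diagK_legInd_anchor` (abstract-weight form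
  `biLoc_comm_diagK_legInd_of_faceBound`) — `BiLoc K q q C δ`, `0 ≤ δ` ⇒
  `BiLoc ([K, diagK(ξ•Σ_{u∈U} legInd ρ u)]) q q (|ξ|·C·e^{δ‖ρ‖₁}·FW^{δ∕2}(q)) (δ∕2)` (g58's (B) was stated for a `LocStencil` family at its own slot
  with a distance WITNESS `R`; here any kernel bi-localised at any `q`, and the witness replaced by the face sum the END consumes).
PARTS 2–6 (separate modules): (α) `dM G` on straddle-reweighted tables; (β) `vertexOfM G` of «flux − commutator»; (γ) the gauge read in layer
form; `Ψ_T` assembled; the END adapter (box nesting, `G`-sandwich, `mmRead`, scalar, `unitS`, fine faces → the END's coarse face sums).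
DISCHARGES NO ROW: no object of an2's typed system occurs; (LAY)'s literal rows, (LT), K-LL-4, the (S) row, the END and (Q-R) are NOT here;
0 estimate of Bałaban's; NOTHING of (Q-R) ∕ (LT) ∕ (Q-L) ∕ (C) ∕ (S) ∕ «T2Shape» ∕ «T2Drift» ∕ (hW, hWall) discharged; NEVER «G-an2-4 closed» as
(CONV-C); NOT D1, NOT `BetaPertH`, NOT continuum, NOT Clay.  2026-08-22.
-/

namespace Summit.QuantumFields.BalabanUV.Beta.GAN24.LayerLetterFaces

open Finset
open scoped BigOperators
open Literature.MathematicalPhysics.QuantumFieldTheory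
open Literature.MathematicalPhysics.QuantumFieldTheory.Balaban1983to89
open Literature.MathematicalPhysics.QuantumFieldTheory.Balaban1983to89.Beta
open Literature.MathematicalPhysics.QuantumFieldTheory.Balaban1983to89.B12Sec2to5 (l1 l1_nonneg)
open B6BondElimination (unitVec)
open ExpKernelCalculus (MKer Site BiLoc comp l1_sub_triangle l1_sub_symm)
open OneStepResolventKernel (Fib)
open KernelWard (divV)
open Summit.QuantumFields.BalabanUV.Beta.ChartConjugation (conjV)
open Summit.QuantumFields.BalabanUV.Beta.BorderedHessian (diagK)
open Summit.QuantumFields.BalabanUV.Beta.AveragingWardRootedStencils (legSite legInd)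
open Summit.QuantumFields.BalabanUV.Beta.GAN24.BlockDivergenceFlux (finsetSum_divV_eq_layers)
open Summit.QuantumFields.BalabanUV.Beta.GAN24.LayerFluxSupport (finset_sum_apply4 sub_apply4 sum_add_sum_factor)
open Summit.QuantumFields.BalabanUV.Beta.GAN24.LayerCommutatorSupport (exists_face_between l1_legSite_sub_le smul_sum_legInd_apply
  comm_diagK_entry)

variable {d : ℕ}

/-! ## §1 The face weight of a finite fine region at an anchor -/

/-- [folklore] ONE LAYER SITE IS DOMINATED BY THE FACE WEIGHT: for `w` in the inner or the outer `μ`-face of `U`,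
`e^{−δ‖w−q‖₁} ≤ FW_U^δ(q)`. -/
theorem exp_le_faceW_of_mem (U : Finset (Site (d + 1))) (δ : ℝ) (q : Site (d + 1)) {μ : Fin (d + 1)} {w : Site (d + 1)}
    (hw : w ∈ U \ U.image (fun v => v - unitVec μ) ∨ w ∈ U.image (fun v => v - unitVec μ) \ U) :
    Real.exp (-δ * l1 (w - q)) ≤ ∑ ν : Fin (d + 1),
      (∑ w' ∈ U.image (fun v => v - unitVec ν) \ U, Real.exp (-δ * l1 (w' - q))
        + ∑ w' ∈ U \ U.image (fun v => v - unitVec ν), Real.exp (-δ * l1 (w' - q))) := by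
  have hterm : Real.exp (-δ * l1 (w - q)) ≤
      ∑ w' ∈ U.image (fun v => v - unitVec μ) \ U, Real.exp (-δ * l1 (w' - q))
        + ∑ w' ∈ U \ U.image (fun v => v - unitVec μ), Real.exp (-δ * l1 (w' - q)) := by
    rcases hw with h | h
    · have h1 : Real.exp (-δ * l1 (w - q)) ≤ ∑ w' ∈ U \ U.image (fun v => v - unitVec μ), Real.exp (-δ * l1 (w' - q)) :=
        Finset.single_le_sum (f := fun w' => Real.exp (-δ * l1 (w' - q))) (fun _ _ => (Real.exp_pos _).le) h
      linarith [Finset.sum_nonneg (s := U.image (fun v => v - unitVec μ) \ U) (f := fun w' => Real.exp (-δ * l1 (w' - q)))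
        (fun _ _ => (Real.exp_pos _).le)]
    · have h1 : Real.exp (-δ * l1 (w - q)) ≤ ∑ w' ∈ U.image (fun v => v - unitVec μ) \ U, Real.exp (-δ * l1 (w' - q)) :=
        Finset.single_le_sum (f := fun w' => Real.exp (-δ * l1 (w' - q))) (fun _ _ => (Real.exp_pos _).le) h
      linarith [Finset.sum_nonneg (s := U \ U.image (fun v => v - unitVec μ)) (f := fun w' => Real.exp (-δ * l1 (w' - q)))
        (fun _ _ => (Real.exp_pos _).le)]
  exact hterm.trans (Finset.single_le_sum (s := Finset.univ) (f := fun ν : Fin (d + 1) =>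
      (∑ w' ∈ U.image (fun v => v - unitVec ν) \ U, Real.exp (-δ * l1 (w' - q))
        + ∑ w' ∈ U \ U.image (fun v => v - unitVec ν), Real.exp (-δ * l1 (w' - q))))
    (fun _ _ => add_nonneg (Finset.sum_nonneg fun _ _ => (Real.exp_pos _).le) (Finset.sum_nonneg fun _ _ => (Real.exp_pos _).le))
    (Finset.mem_univ μ))

/-- [folklore] The face weight is nonnegative. -/
theorem faceW_nonneg (U : Finset (Site (d + 1))) (δ : ℝ) (q : Site (d + 1)) :
    0 ≤ ∑ ν : Fin (d + 1),
      (∑ w' ∈ U.image (fun v => v - unitVec ν) \ U, Real.exp (-δ * l1 (w' - q))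
        + ∑ w' ∈ U \ U.image (fun v => v - unitVec ν), Real.exp (-δ * l1 (w' - q))) :=
  Finset.sum_nonneg fun _ _ =>
    add_nonneg (Finset.sum_nonneg fun _ _ => (Real.exp_pos _).le) (Finset.sum_nonneg fun _ _ => (Real.exp_pos _).le)

/-- [folklore] MONOTONICITY IN THE RATE: a smaller rate gives a larger face weight (`δ′ ≤ δ ⇒ FW^δ ≤ FW^{δ′}`) — the END's displayed rate
`δ` is free, so every piece may be read at the smallest rate in play. -/
theorem faceW_mono_rate (U : Finset (Site (d + 1))) {δ δ' : ℝ} (h : δ' ≤ δ) (q : Site (d + 1)) :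
    (∑ ν : Fin (d + 1),
      (∑ w' ∈ U.image (fun v => v - unitVec ν) \ U, Real.exp (-δ * l1 (w' - q))
        + ∑ w' ∈ U \ U.image (fun v => v - unitVec ν), Real.exp (-δ * l1 (w' - q))))
      ≤ ∑ ν : Fin (d + 1),
      (∑ w' ∈ U.image (fun v => v - unitVec ν) \ U, Real.exp (-δ' * l1 (w' - q))
        + ∑ w' ∈ U \ U.image (fun v => v - unitVec ν), Real.exp (-δ' * l1 (w' - q))) := by
  have hmono : ∀ w' : Site (d + 1), Real.exp (-δ * l1 (w' - q)) ≤ Real.exp (-δ' * l1 (w' - q)) := fun w' => by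
    rw [Real.exp_le_exp]
    nlinarith [l1_nonneg (w' - q)]
  exact Finset.sum_le_sum fun ν _ => add_le_add (Finset.sum_le_sum fun w' _ => hmono w') (Finset.sum_le_sum fun w' _ => hmono w')

/-- [folklore] RE-ANCHORING: `FW^δ(q) ≤ e^{δ‖q−q′‖₁}·FW^δ(q′)` for `0 ≤ δ` (one triangle inequality per layer site) — a face letter anchored at a
table position `N•w` is re-read at the slot anchor `N•y′` at the price of the column's own decay. -/
theorem faceW_reanchor (U : Finset (Site (d + 1))) {δ : ℝ} (hδ : 0 ≤ δ) (q q' : Site (d + 1)) :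
    (∑ ν : Fin (d + 1),
      (∑ w' ∈ U.image (fun v => v - unitVec ν) \ U, Real.exp (-δ * l1 (w' - q))
        + ∑ w' ∈ U \ U.image (fun v => v - unitVec ν), Real.exp (-δ * l1 (w' - q))))
      ≤ Real.exp (δ * l1 (q - q')) * ∑ ν : Fin (d + 1),
      (∑ w' ∈ U.image (fun v => v - unitVec ν) \ U, Real.exp (-δ * l1 (w' - q'))
        + ∑ w' ∈ U \ U.image (fun v => v - unitVec ν), Real.exp (-δ * l1 (w' - q'))) := by
  have hterm : ∀ w' : Site (d + 1), Real.exp (-δ * l1 (w' - q)) ≤ Real.exp (δ * l1 (q - q')) * Real.exp (-δ * l1 (w' - q')) := by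
    intro w'
    rw [← Real.exp_add, Real.exp_le_exp]
    have ht : l1 (w' - q') ≤ l1 (w' - q) + l1 (q - q') := l1_sub_triangle w' q q'
    nlinarith [l1_nonneg (w' - q), l1_nonneg (q - q')]
  rw [Finset.mul_sum]
  refine Finset.sum_le_sum fun ν _ => ?_
  rw [mul_add, Finset.mul_sum, Finset.mul_sum]
  exact add_le_add (Finset.sum_le_sum fun w' _ => hterm w') (Finset.sum_le_sum fun w' _ => hterm w')

/-! ## §2 Straddles: a pair of points on opposite sides of `∂U` sees a layer site, from any anchor -/

/-- [folklore] **A STRADDLING PAIR SEES A LAYER SITE FROM ANY ANCHOR.**  If `r₁ ∈ U` and `r₂ ∉ U` then some site `w` of the discrete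
boundary layer of `U` (inner or outer `μ`-face, `LayerCommutatorSupport.mem_faces_iff`) satisfies `‖w − q‖₁ ≤ ‖r₁ − q‖₁ + ‖r₂ − q‖₁` for EVERY
anchor `q` (`exists_face_between` puts `w` `ℓ¹`-between `r₁` and `r₂`; two triangle inequalities). -/
theorem exists_face_l1_le (U : Finset (Site (d + 1))) {r₁ r₂ : Site (d + 1)} (h₁ : r₁ ∈ U) (h₂ : r₂ ∉ U) (q : Site (d + 1)) :
    ∃ μ w, (w ∈ U \ U.image (fun v => v - unitVec μ) ∨ w ∈ U.image (fun v => v - unitVec μ) \ U)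
      ∧ l1 (w - q) ≤ l1 (r₁ - q) + l1 (r₂ - q) := by
  obtain ⟨μ, w, hw, hdist⟩ := exists_face_between U h₁ h₂
  refine ⟨μ, w, hw, ?_⟩
  have t1 : l1 (w - q) ≤ l1 (w - r₁) + l1 (r₁ - q) := l1_sub_triangle w r₁ q
  have t2 : l1 (w - q) ≤ l1 (w - r₂) + l1 (r₂ - q) := l1_sub_triangle w r₂ q
  have t3 : l1 (r₁ - r₂) ≤ l1 (r₁ - q) + l1 (q - r₂) := l1_sub_triangle r₁ q r₂
  rw [l1_sub_symm q r₂] at t3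
  linarith

/-- [folklore] **THE STRADDLE INEQUALITY**: `r₁ ∈ U`, `r₂ ∉ U`, `0 ≤ δ` ⇒
`e^{−δ(‖r₁−q‖₁+‖r₂−q‖₁)} ≤ FW_U^{δ∕2}(q)·e^{−(δ∕2)(‖r₁−q‖₁+‖r₂−q‖₁)}` — half the decay of a straddling kernel pair pays for the distance from the anchor
to the boundary layer. -/
theorem exp_straddle_le_faceW (U : Finset (Site (d + 1))) {r₁ r₂ : Site (d + 1)} (h₁ : r₁ ∈ U) (h₂ : r₂ ∉ U) {δ : ℝ} (hδ : 0 ≤ δ)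
    (q : Site (d + 1)) :
    Real.exp (-δ * (l1 (r₁ - q) + l1 (r₂ - q)))
      ≤ (∑ ν : Fin (d + 1),
          (∑ w' ∈ U.image (fun v => v - unitVec ν) \ U, Real.exp (-(δ / 2) * l1 (w' - q))
            + ∑ w' ∈ U \ U.image (fun v => v - unitVec ν), Real.exp (-(δ / 2) * l1 (w' - q))))
        * Real.exp (-(δ / 2) * (l1 (r₁ - q) + l1 (r₂ - q))) := by
  obtain ⟨μ, w, hw, hle⟩ := exists_face_l1_le U h₁ h₂ q
  have hF := exp_le_faceW_of_mem U (δ / 2) q hw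
  have hsplit : Real.exp (-δ * (l1 (r₁ - q) + l1 (r₂ - q)))
      ≤ Real.exp (-(δ / 2) * l1 (w - q)) * Real.exp (-(δ / 2) * (l1 (r₁ - q) + l1 (r₂ - q))) := by
    rw [← Real.exp_add, Real.exp_le_exp]
    nlinarith
  exact hsplit.trans (mul_le_mul_of_nonneg_right hF (Real.exp_pos _).le)

/-- [folklore] **THE WEIGHT LEMMA OF THE ROTATED-VERTEX PIECE (α), ABSTRACT WEIGHT.**  A `dM`-read of the commutator `[G, X_T]`
reweights each table by «symbol at the SLOT leg `s` minus symbol at the TABLE leg `t`» (p2 g38 `WardResidualRotatedVertex.dM_conjV_diagK`); for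
the summed block generator the symbol is `ξ·𝟙_U` of the leg (`LayerCommutatorSupport.smul_sum_legInd_apply`).  Against a column decaying like
`e^{−δ‖v−q‖₁}` from the anchor (`v` = the table position the column is read at, `‖t − v‖₁` = the leg offset), for ANY `W ≥ 0` dominating
`e^{−(δ∕2)‖w−q‖₁}` at every layer site `w` of `U`:
`|𝟙_U(s)ξ − 𝟙_U(t)ξ|·e^{−δ‖v−q‖₁} ≤ |ξ|·e^{(δ∕2)(‖s−q‖₁+‖t−v‖₁)}·W·e^{−(δ∕2)‖v−q‖₁}` (`0 ≤ δ`) — zero unless the legs straddle `∂U`, else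
`exists_face_l1_le` and half the column decay.  (`W :=` the face weight `FW_U^{δ∕2}(q)`: `indDiff_mul_exp_le_faceW`; `W := e^{−(δ∕2)R}` for a
distance witness `R` is the other reading.) -/
theorem indDiff_mul_exp_le_of_faceBound (U : Finset (Site (d + 1))) (ξ : ℝ) {δ : ℝ} (hδ : 0 ≤ δ) (q s t v : Site (d + 1)) {W : ℝ}
    (hW0 : 0 ≤ W)
    (hW : ∀ μ w, (w ∈ U \ U.image (fun v => v - unitVec μ) ∨ w ∈ U.image (fun v => v - unitVec μ) \ U) →
      Real.exp (-(δ / 2) * l1 (w - q)) ≤ W) :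
    |(if s ∈ U then ξ else 0) - (if t ∈ U then ξ else 0)| * Real.exp (-δ * l1 (v - q))
      ≤ |ξ| * Real.exp ((δ / 2) * (l1 (s - q) + l1 (t - v))) * W * Real.exp (-(δ / 2) * l1 (v - q)) := by
  have hRHS : 0 ≤ |ξ| * Real.exp ((δ / 2) * (l1 (s - q) + l1 (t - v))) * W * Real.exp (-(δ / 2) * l1 (v - q)) := by positivity
  -- the straddling case, symmetric in the two legs
  have straddle : ∀ {r₁ r₂ : Site (d + 1)}, r₁ ∈ U → r₂ ∉ U → l1 (r₁ - q) + l1 (r₂ - q) ≤ l1 (s - q) + l1 (t - v) + l1 (v - q) →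
      |ξ| * Real.exp (-δ * l1 (v - q))
        ≤ |ξ| * Real.exp ((δ / 2) * (l1 (s - q) + l1 (t - v))) * W * Real.exp (-(δ / 2) * l1 (v - q)) := by
    intro r₁ r₂ hr₁ hr₂ hsum
    obtain ⟨μ, w, hw, hle⟩ := exists_face_l1_le U hr₁ hr₂ q
    have hF := hW μ w hw
    have hsplit : Real.exp (-δ * l1 (v - q))
        ≤ Real.exp ((δ / 2) * (l1 (s - q) + l1 (t - v))) * Real.exp (-(δ / 2) * l1 (w - q)) * Real.exp (-(δ / 2) * l1 (v - q)) := by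
      rw [← Real.exp_add, ← Real.exp_add, Real.exp_le_exp]
      nlinarith
    calc |ξ| * Real.exp (-δ * l1 (v - q))
        ≤ |ξ| * (Real.exp ((δ / 2) * (l1 (s - q) + l1 (t - v))) * Real.exp (-(δ / 2) * l1 (w - q)) * Real.exp (-(δ / 2) * l1 (v - q))) :=
          mul_le_mul_of_nonneg_left hsplit (abs_nonneg _)
      _ ≤ |ξ| * (Real.exp ((δ / 2) * (l1 (s - q) + l1 (t - v))) * W * Real.exp (-(δ / 2) * l1 (v - q))) :=
          mul_le_mul_of_nonneg_left (mul_le_mul_of_nonneg_right (mul_le_mul_of_nonneg_left hF (Real.exp_pos _).le)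
            (Real.exp_pos _).le) (abs_nonneg _)
      _ = _ := by ring
  have hts : l1 (t - q) ≤ l1 (t - v) + l1 (v - q) := l1_sub_triangle t v q
  by_cases hs : s ∈ U <;> by_cases ht : t ∈ U
  · rw [if_pos hs, if_pos ht, sub_self, abs_zero, zero_mul]; exact hRHS
  · rw [if_pos hs, if_neg ht, sub_zero]
    exact straddle hs ht (by linarith)
  · rw [if_neg hs, if_pos ht, zero_sub, abs_neg]
    exact straddle ht hs (by linarith)
  · rw [if_neg hs, if_neg ht, sub_self, abs_zero, zero_mul]; exact hRHS

/-- [folklore] **THE WEIGHT LEMMA OF (α), FACE-SUM FORM**: `W :=` the face weight `FW_U^{δ∕2}(q)` in `indDiff_mul_exp_le_of_faceBound`. -/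
theorem indDiff_mul_exp_le_faceW (U : Finset (Site (d + 1))) (ξ : ℝ) {δ : ℝ} (hδ : 0 ≤ δ) (q s t v : Site (d + 1)) :
    |(if s ∈ U then ξ else 0) - (if t ∈ U then ξ else 0)| * Real.exp (-δ * l1 (v - q))
      ≤ |ξ| * Real.exp ((δ / 2) * (l1 (s - q) + l1 (t - v)))
        * (∑ ν : Fin (d + 1),
          (∑ w' ∈ U.image (fun v => v - unitVec ν) \ U, Real.exp (-(δ / 2) * l1 (w' - q))
            + ∑ w' ∈ U \ U.image (fun v => v - unitVec ν), Real.exp (-(δ / 2) * l1 (w' - q))))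
        * Real.exp (-(δ / 2) * l1 (v - q)) :=
  indDiff_mul_exp_le_of_faceBound U ξ hδ q s t v (faceW_nonneg U (δ / 2) q) (fun _ _ hw => exp_le_faceW_of_mem U (δ / 2) q hw)

/-! ## §3 (A) at a general anchor: the block-summed divergence of a family bi-localised at `q` -/

/-- [folklore] **(LAY) SUPPORT LEMMA (A) AT A GENERAL ANCHOR.**  A first-order family `F μ x′` of kernels, each bi-localised at the
anchor `q` with a constant decaying in the distance of ITS POSITION `x′` from `q` (`BiLoc (F μ x′) q q (C·e^{−δ‖x′−q‖₁}) δ`), summed as a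
backward divergence over any finite region `U`, is bi-localised at `q` with constant `C·FW_U^δ(q)` — by this lineage's
`BlockDivergenceFlux.finsetSum_divV_eq_layers` only the two boundary layers of `U` survive.  (g58's `LayerFluxSupport.biLoc_finsetSum_divV_weight`
is the case «anchor = the table's own slot point»; the mixed-remainder piece (β) of `Ψ` needs the anchor at a dilated multiplier slot `N•w`.) -/
theorem biLoc_finsetSum_divV_anchor {F : Fin (d + 1) → Site (d + 1) → MKer (d + 1) (Fib d)} {C δ : ℝ} {q : Site (d + 1)}
    (hF : ∀ μ x', BiLoc (F μ x') q q (C * Real.exp (-δ * l1 (x' - q))) δ) (U : Finset (Site (d + 1))) :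
    BiLoc (∑ x' ∈ U, divV F x') q q
      (C * ∑ ν : Fin (d + 1),
          (∑ w' ∈ U.image (fun v => v - unitVec ν) \ U, Real.exp (-δ * l1 (w' - q))
            + ∑ w' ∈ U \ U.image (fun v => v - unitVec ν), Real.exp (-δ * l1 (w' - q)))) δ := by
  intro x z a b
  rw [finsetSum_divV_eq_layers U F, finset_sum_apply4]
  set A : ℝ := l1 (x - q) + l1 (z - q) with hA
  have hent : ∀ μ w, |F μ w x z a b| ≤ C * Real.exp (-δ * l1 (w - q)) * Real.exp (-δ * A) := fun μ w => hF μ w x z a b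
  calc |∑ μ, (∑ w ∈ U.image (fun v => v - unitVec μ) \ U, F μ w
            - ∑ w ∈ U \ U.image (fun v => v - unitVec μ), F μ w) x z a b|
      ≤ ∑ μ, |(∑ w ∈ U.image (fun v => v - unitVec μ) \ U, F μ w
            - ∑ w ∈ U \ U.image (fun v => v - unitVec μ), F μ w) x z a b| := Finset.abs_sum_le_sum_abs _ _
    _ ≤ ∑ μ, (∑ w ∈ U.image (fun v => v - unitVec μ) \ U, C * Real.exp (-δ * l1 (w - q)) * Real.exp (-δ * A)
            + ∑ w ∈ U \ U.image (fun v => v - unitVec μ), C * Real.exp (-δ * l1 (w - q)) * Real.exp (-δ * A)) := by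
        refine Finset.sum_le_sum fun μ _ => ?_
        rw [sub_apply4, finset_sum_apply4, finset_sum_apply4]
        refine (abs_sub _ _).trans (add_le_add ?_ ?_)
        · exact (Finset.abs_sum_le_sum_abs _ _).trans (Finset.sum_le_sum fun w _ => hent μ w)
        · exact (Finset.abs_sum_le_sum_abs _ _).trans (Finset.sum_le_sum fun w _ => hent μ w)
    _ = C * (∑ μ, (∑ w ∈ U.image (fun v => v - unitVec μ) \ U, Real.exp (-δ * l1 (w - q))
              + ∑ w ∈ U \ U.image (fun v => v - unitVec μ), Real.exp (-δ * l1 (w - q))))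
          * Real.exp (-δ * A) := by
        rw [Finset.mul_sum, Finset.sum_mul]
        exact Finset.sum_congr rfl fun μ _ => sum_add_sum_factor _ _ _ _ _

/-! ## §4 (B) at a general anchor, face-sum form: the commutator with the summed block generator -/

/-- [folklore] **(LAY) SUPPORT LEMMA (B) AT A GENERAL ANCHOR, ABSTRACT WEIGHT.**  For ANY kernel `K` bi-localised at ANY anchor `q`
(`BiLoc K q q C δ`, `0 ≤ δ`), any finite fine region `U`, root offset `ρ`, weight `ξ`, and any `W ≥ 0` dominating `e^{−(δ∕2)‖w−q‖₁}` at every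
layer site `w` of `U`: `BiLoc (K ∘ diagK(ξ•Σ_{u∈U} legInd ρ u) − diagK(…) ∘ K) q q (|ξ|·C·e^{δ‖ρ‖₁}·W) (δ∕2)`.
An entry `K x z a b·(g z b − g x a)` (`comm_diagK_entry`) vanishes unless the legs `legSite ρ x a`, `legSite ρ z b` straddle `U`; then
`exists_face_l1_le` gives a layer site `w` with `‖w−q‖₁ ≤ ‖x−q‖₁ + ‖z−q‖₁ + 2‖ρ‖₁` (`l1_legSite_sub_le`) and HALF of the kernel's decay pays
`e^{−(δ∕2)‖w−q‖₁} ≤ W`.  (g58's `LayerCommutatorSupport.biLoc_comm_diagK_legInd` is the case of a `LocStencil` family at its own slot with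
`W = e^{−(δ∕2)R}`; the vertex-family tables `M1 ρ′ w` of the mixed-remainder piece (β) are anchored at `N•w`, hence the general anchor.) -/
theorem biLoc_comm_diagK_legInd_of_faceBound {K : MKer (d + 1) (Fib d)} {C δ : ℝ} {q : Site (d + 1)} (hK : BiLoc K q q C δ)
    (hδ : 0 ≤ δ) (U : Finset (Site (d + 1))) (ρ : Site (d + 1)) (ξ : ℝ) {W : ℝ} (hW0 : 0 ≤ W)
    (hW : ∀ μ w, (w ∈ U \ U.image (fun v => v - unitVec μ) ∨ w ∈ U.image (fun v => v - unitVec μ) \ U) →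
      Real.exp (-(δ / 2) * l1 (w - q)) ≤ W) :
    BiLoc (comp K (diagK (ξ • ∑ u ∈ U, legInd ρ u)) - comp (diagK (ξ • ∑ u ∈ U, legInd ρ u)) K) q q
      (|ξ| * C * Real.exp (δ * l1 ρ) * W) (δ / 2) := by
  intro x z a b
  rw [comm_diagK_entry, smul_sum_legInd_apply, smul_sum_legInd_apply]
  have hC : 0 ≤ C := hK.nonneg (Sum.inr 0)
  set A : ℝ := l1 (x - q) + l1 (z - q) with hA
  have hKx : |K x z a b| ≤ C * Real.exp (-δ * A) := hK x z a b
  have hRHS : 0 ≤ |ξ| * C * Real.exp (δ * l1 ρ) * W * Real.exp (-(δ / 2) * A) := by positivity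
  -- the straddling case, symmetric in the two legs
  have straddle : ∀ {r₁ r₂ : Site (d + 1)}, r₁ ∈ U → r₂ ∉ U →
      l1 (r₁ - q) + l1 (r₂ - q) ≤ A + 2 * l1 ρ →
      |K x z a b| * |ξ| ≤ |ξ| * C * Real.exp (δ * l1 ρ) * W * Real.exp (-(δ / 2) * A) := by
    intro r₁ r₂ h₁ h₂ hsum
    obtain ⟨μ, w, hw, hle⟩ := exists_face_l1_le U h₁ h₂ q
    have hF := hW μ w hw
    have hwq : l1 (w - q) ≤ A + 2 * l1 ρ := hle.trans hsum
    have hexp : Real.exp (-δ * A) ≤ Real.exp (δ * l1 ρ) * Real.exp (-(δ / 2) * l1 (w - q)) * Real.exp (-(δ / 2) * A) := by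
      rw [← Real.exp_add, ← Real.exp_add, Real.exp_le_exp]
      nlinarith
    calc |K x z a b| * |ξ| ≤ C * Real.exp (-δ * A) * |ξ| := mul_le_mul_of_nonneg_right hKx (abs_nonneg _)
      _ ≤ C * (Real.exp (δ * l1 ρ) * Real.exp (-(δ / 2) * l1 (w - q)) * Real.exp (-(δ / 2) * A)) * |ξ| :=
          mul_le_mul_of_nonneg_right (mul_le_mul_of_nonneg_left hexp hC) (abs_nonneg _)
      _ ≤ C * (Real.exp (δ * l1 ρ) * W * Real.exp (-(δ / 2) * A)) * |ξ| :=
          mul_le_mul_of_nonneg_right (mul_le_mul_of_nonneg_left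
            (mul_le_mul_of_nonneg_right (mul_le_mul_of_nonneg_left hF (Real.exp_pos _).le) (Real.exp_pos _).le) hC) (abs_nonneg _)
      _ = _ := by ring
  have hb1 := l1_legSite_sub_le ρ x a q
  have hb2 := l1_legSite_sub_le ρ z b q
  by_cases h1 : legSite ρ x a ∈ U <;> by_cases h2 : legSite ρ z b ∈ U
  · rw [if_pos h1, if_pos h2, sub_self, mul_zero, abs_zero]; exact hRHS
  · rw [if_neg h2, if_pos h1, zero_sub, mul_neg, abs_neg, abs_mul]
    exact straddle h1 h2 (by linarith)
  · rw [if_pos h2, if_neg h1, sub_zero, abs_mul]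
    exact straddle (r₁ := legSite ρ z b) (r₂ := legSite ρ x a) h2 h1 (by linarith)
  · rw [if_neg h1, if_neg h2, sub_self, mul_zero, abs_zero]; exact hRHS

/-- [folklore] **(LAY) SUPPORT LEMMA (B) AT A GENERAL ANCHOR, IN FACE-SUM FORM** (`W :=` the face weight `FW_U^{δ∕2}(q)` — the END consumes
face sums): `BiLoc K q q C δ`, `0 ≤ δ` ⇒ `BiLoc ([K, diagK(ξ•Σ_{u∈U} legInd ρ u)]) q q (|ξ|·C·e^{δ‖ρ‖₁}·FW_U^{δ∕2}(q)) (δ∕2)`. -/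
theorem biLoc_comm_diagK_legInd_anchor {K : MKer (d + 1) (Fib d)} {C δ : ℝ} {q : Site (d + 1)} (hK : BiLoc K q q C δ) (hδ : 0 ≤ δ)
    (U : Finset (Site (d + 1))) (ρ : Site (d + 1)) (ξ : ℝ) :
    BiLoc (comp K (diagK (ξ • ∑ u ∈ U, legInd ρ u)) - comp (diagK (ξ • ∑ u ∈ U, legInd ρ u)) K) q q
      (|ξ| * C * Real.exp (δ * l1 ρ)
        * ∑ ν : Fin (d + 1),
          (∑ w' ∈ U.image (fun v => v - unitVec ν) \ U, Real.exp (-(δ / 2) * l1 (w' - q))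
            + ∑ w' ∈ U \ U.image (fun v => v - unitVec ν), Real.exp (-(δ / 2) * l1 (w' - q)))) (δ / 2) :=
  biLoc_comm_diagK_legInd_of_faceBound hK hδ U ρ ξ (faceW_nonneg U (δ / 2) q) (fun _ _ hw => exp_le_faceW_of_mem U (δ / 2) q hw)

/-- [folklore] The `conjV` spelling (`conjV K X = K∘X − X∘K`, the Ward kernel law's generator action): the same bound. -/
theorem biLoc_conjV_diagK_legInd_anchor {K : MKer (d + 1) (Fib d)} {C δ : ℝ} {q : Site (d + 1)} (hK : BiLoc K q q C δ) (hδ : 0 ≤ δ)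
    (U : Finset (Site (d + 1))) (ρ : Site (d + 1)) (ξ : ℝ) :
    BiLoc (conjV K (diagK (ξ • ∑ u ∈ U, legInd ρ u))) q q
      (|ξ| * C * Real.exp (δ * l1 ρ)
        * ∑ ν : Fin (d + 1),
          (∑ w' ∈ U.image (fun v => v - unitVec ν) \ U, Real.exp (-(δ / 2) * l1 (w' - q))
            + ∑ w' ∈ U \ U.image (fun v => v - unitVec ν), Real.exp (-(δ / 2) * l1 (w' - q)))) (δ / 2) :=
  biLoc_comm_diagK_legInd_anchor hK hδ U ρ ξ

end Summit.QuantumFields.BalabanUV.Beta.GAN24.LayerLetterFaces
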